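import Literature.MathematicalPhysics.QuantumFieldTheory.Balaban1983to89.Node00.BackgroundSelOfRecord
import Summits.QuantumFields.YangMills.Theorems.BalabanUVNodesN09AxialCovariance181
import Literature.MathematicalPhysics.QuantumFieldTheory.Balaban1983to89.B15Claim189UnitTestAtRecord

/-!
# NODE N09 — THE OFFER `UkSel` AT THE JUNCTION: (181)ˢᵒˡ covariance of `M^j ∘ UkSel` from [B11] uniqueness ALONE (p591459's `hcov` shape, no axial convention),
# RE-SELECTION INVARIANCE of the junction's other `U_k`-mentioning binders (`huniq`, `hnest`), and NON-VACUITY of the solvable set at every level (`U₀ = 1` over `V = 1`)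

TRACK A (YM-PLAN §2d, node N09 of 28 = [Balaban1987RG1] Sects 2–5, `Dag.B12_main`), cell `pub-ymgap`, seat `pub-ymgap-dag-n09-w4` (g2; D-0149 width seat 4∕4), FILE 4.
Key of record: K1⁷ `StabilityBAtRecordR13SepCoPH` = stmt-QuantumFields-20542; this file `--supports` it AS A HELPER (count-neutral).
[I] = [Balaban1987RG1] (CMP 109), [B11] = [Balaban1985Variational] (CMP 102).

WHY.  The N09 Theorem-3 member at the Stage-13 record is displayed by dag-n09-w2's junctions ★ `thm3Member_stage13SepCoPH_of_stepsOnLoc` (p591459: binder `hcov` =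
(181)ˢᵒˡ block-lift covariance of the critical configuration `critCfgOfRecord = M^j ∘ Uk` at every SOLVABLE coarse field) and ★ `…_of_stepsOnLoc_of_axialOn` (p593803:
`hcov` traded for [B11] uniqueness `huniqD` + the axial CONVENTION `haxD`).  For node00-def-B's bare choice `Uk` neither `hcov` nor `haxD` is provable.  This seat's OFFER
`Node00.UkSel` (p594976: `U_k` read in the rooted gauge through a measurable selector) needs NO convention: THIS FILE shows
* §1 ★ `iter_UkSel_covariantOn_solvable` — p591459's `hcov j` VERBATIM with `critCfgOfRecord ↦ M^j ∘ UkSel (j+1)`, from ONE displayed [B11] input «uniqueness wherever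
  solvable» (`hsolU : UkExists → UniqueUkOrbit` at radius `ε`, level `j+1`); and the `D`-local form `iter_UkSel_covariantOn_of_stable` from `hDsol` ∕ `huniqD` ∕ `hDst`
  (p593803's letters, `haxD` NOT needed).
* §2 RE-SELECTION INVARIANCE — the junction's remaining `U_k`-mentioning binders do not see the representative: for `U, U'` in one residual orbit of level `k`,
  `uniqueUkOrbit_iter_iff_of_orbitRel` (`huniq`'s body at `M^{j+1}U` vs `M^{j+1}U'`, via dag-n09-w2 `uniqueUkOrbit_gaugeAct_iff`) and `mem_iter_iff_of_orbitRel_of_stable`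
  (`hnest`'s body, for bookkeeping sets `D j` stable under level-`j` gauge transformations); hence `huniq_UkSel_iff` ∕ `hnest_UkSel_iff` — under `h11`'s uniqueness at `V`
  the binders `huniq` ∕ `hnest` hold for `UkSel` IFF they hold for `Uk`.  So the re-point `Uk ↦ UkSel` changes the junction ONLY where it must: `hcov`∕`haxD` (now a
  theorem) and (H-U)∕(I19) (now `measurable_UkSel`).
* §3 NON-VACUITY at EVERY level (A6): `isBackground_one_one` — over the unit coarse field the unit fine field IS a (0.21) minimiser (`M^k 1 = 1`, dag-n12-e's
  `B15Claim189UnitTestAtRecord.iter_avOfRecord_one`; `A(1) = 0 ≤ A(U)`), so `ukExists_one : 0 < ε → UkExists F N K k ε 1`: the solvable set — the domain of §1 and of FILE 1∕3's contracts — is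
  inhabited at every `K, k, ε > 0` (uniqueness at `V = 1`, `k ≥ 1`, is [B11]'s and stays displayed).

HONEST FRAMING — what this is NOT.  Composition by name over FILE 3 (`UkSel_gaugeAct_blockLift`, `orbitRel_Uk_UkSel`), r13 `iter_gaugeAct`, dag-n09-w2's
`uniqueUkOrbit_gaugeAct_iff` ∕ `ukExists_gaugeAct_iff`, dag-n12-e's `iter_avOfRecord_one`, FILE 3's `one_mem_bgReg`; NOTHING of Bałaban's asserted ([B11] Thm 1 enters only as hypotheses); NO carrier of record
re-pointed, NO junction re-keyed (that is dag-n24-c's ∕ dag-n09-w2's on a record edition); NOT a discharge of N09; K0⁷ ∕ K1⁷ NOT closed; counts unmoved (typed 28∕28 ·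
discharged 5∕27); one finite four-torus programme at fixed `ε = L^{−K}` — R4 closes the conditional rung `BalabanLadder.UV` only; NOT continuum ∕ ℝ⁴ ∕ OS; the YM mass gap
(Clay) is NOT proved by any of this.  THEOREMS ONLY (0 `def`, 0 `sorry`, 0 `instance`, 0 `notation`).
-/

noncomputable section

namespace Summit.QuantumFields.YangMills.BalabanUVNodes.N09UkSelAtJunction

open MeasureTheory Set
open Literature.MathematicalPhysics.QuantumFieldTheory.Balaban1983to89
open Literature.MathematicalPhysics.QuantumFieldTheory.Balaban1983to89.Node00
  (SU Uk UkExists UniqueUkOrbit bgReg avOfRecord isBackground_Uk Uk_of_not mem_bgReg_iff UkSel isBackground_UkSel UkSel_gaugeAct_blockLift orbitRel_Uk_UkSel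
    ukExists_gaugeAct_iff' toMS_blockLift_succ' Stage13Params wilsonAction4_eq_of_isBackground)
open B12GaugeOrbits021 (OrbitRel IsResidual)
open B15Eq177GaugeInvariance (blockLift)
open B16Sect1Backgrounds (toMS iter_gaugeAct)
open B12RTGaugeInvariance254 (liftTransf)
open Summit.QuantumFields.YangMills.BalabanUVNodes.N09AxialCovariance181 (uniqueUkOrbit_gaugeAct_iff)
open B15Claim189UnitTestAtRecord (iter_avOfRecord_one)
open GaugeField (gaugeAct)

variable {F : T4Continuum.T4Family} {N : ℕ} [NeZero N] {K : ℕ} {ε : ℝ}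

/-! ## §1  ★ (181)ˢᵒˡ for `M^j ∘ UkSel` from [B11] uniqueness alone — p591459's `hcov` shape, no axial convention -/

/-- **★ p591459's `hcov j` FOR THE OFFER, FROM UNIQUENESS WHEREVER SOLVABLE**: if at level `j+1` and radius `ε` every solvable coarse field has a unique minimal orbit
(`hsolU`, [B11] Thm 1 — DISPLAYED), then the (2.3)-shaped critical configuration through `UkSel`, `W ↦ M^j(UkSel_{j+1} W)`, is block-lift covariant at EVERY solvable `W`:
`M^j(UkSel (W^v)) = (M^j(UkSel W))^{v∘blockOf}` (FILE 3 `UkSel_gaugeAct_blockLift` + r13 `iter_gaugeAct`; solvability is gauge invariant).  Standing range `j + 1 ≤ m + K`.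
[cite: Balaban1985Variational, (181) p.307 and Thm 1 p.279; Balaban1987RG1, (2.3) p.265] -/
theorem iter_UkSel_covariantOn_solvable {j : ℕ} (hj : j + 1 ≤ (F.P K).m + (F.P K).K)
    (hsolU : ∀ W : GaugeField (F.P K) (j + 1) (SU N), UkExists F N K (j + 1) ε W → UniqueUkOrbit F N K (j + 1) ε W) :
    ∀ (v : GaugeTransf (F.P K) (j + 1) (SU N)) (W : GaugeField (F.P K) (j + 1) (SU N)), UkExists F N K (j + 1) ε W →
      Averaging.iter (avOfRecord F N K) j (UkSel F N K (j + 1) ε (gaugeAct v W)) =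
        gaugeAct (liftTransf v) (Averaging.iter (avOfRecord F N K) j (UkSel F N K (j + 1) ε W)) := by
  intro v W hW
  have hW' : UkExists F N K (j + 1) ε (gaugeAct v W) := (ukExists_gaugeAct_iff' hj v W).2 hW
  rw [UkSel_gaugeAct_blockLift hj v hW (hsolU _ hW'), iter_gaugeAct (avOfRecord F N K) _ _ j (Nat.le_of_succ_le hj), toMS_blockLift_succ' (Nat.le_of_succ_le hj)]

/-- **The `D`-local form** (p593803's letters `hDsol` ∕ `huniqD` ∕ `hDst`, NO `haxD`): on a gauge-stable set `D` of solvable coarse fields with unique minimal orbits,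
`M^j ∘ UkSel_{j+1}` is block-lift covariant. [cite: Balaban1985Variational, (181) p.307 and Thm 1 p.279] -/
theorem iter_UkSel_covariantOn_of_stable {j : ℕ} (hj : j + 1 ≤ (F.P K).m + (F.P K).K) {D : Set (GaugeField (F.P K) (j + 1) (SU N))}
    (hDsol : ∀ W ∈ D, UkExists F N K (j + 1) ε W) (huniqD : ∀ W ∈ D, UniqueUkOrbit F N K (j + 1) ε W)
    (hDst : ∀ (v : GaugeTransf (F.P K) (j + 1) (SU N)) (W : GaugeField (F.P K) (j + 1) (SU N)), W ∈ D → gaugeAct v W ∈ D) :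
    ∀ (v : GaugeTransf (F.P K) (j + 1) (SU N)) (W : GaugeField (F.P K) (j + 1) (SU N)), W ∈ D →
      Averaging.iter (avOfRecord F N K) j (UkSel F N K (j + 1) ε (gaugeAct v W)) =
        gaugeAct (liftTransf v) (Averaging.iter (avOfRecord F N K) j (UkSel F N K (j + 1) ε W)) := by
  intro v W hW
  rw [UkSel_gaugeAct_blockLift hj v (hDsol W hW) (huniqD _ (hDst v W hW)), iter_gaugeAct (avOfRecord F N K) _ _ j (Nat.le_of_succ_le hj),
    toMS_blockLift_succ' (Nat.le_of_succ_le hj)]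

/-- **Run-indexed packaging = p591459's binder `hcov` with `critCfgOfRecord θ.ν P.K j ↦ M^j ∘ UkSel_{j+1}` at radius `θ.ν.εreg`**, from uniqueness wherever solvable at the
steps `j < K` (the day the record reads `U_{j+1}` through `UkSel`, this is the supplier of that binder; nothing re-keyed here). [cite: Balaban1985Variational, (181) p.307 and Thm 1 p.279] -/
theorem hcovSol_UkSel (θ₀ : Stage13Params F N) (P : B12.RunParams)
    (hsolU : ∀ j < P.K, ∀ W : GaugeField (F.P P.K) (j + 1) (SU N), UkExists F N P.K (j + 1) θ₀.ν.εreg W → UniqueUkOrbit F N P.K (j + 1) θ₀.ν.εreg W) :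
    ∀ j < P.K, ∀ (v : GaugeTransf (F.P P.K) (j + 1) (SU N)) (W : GaugeField (F.P P.K) (j + 1) (SU N)), UkExists F N P.K (j + 1) θ₀.ν.εreg W →
      Averaging.iter (avOfRecord F N P.K) j (UkSel F N P.K (j + 1) θ₀.ν.εreg (gaugeAct v W)) =
        gaugeAct (liftTransf v) (Averaging.iter (avOfRecord F N P.K) j (UkSel F N P.K (j + 1) θ₀.ν.εreg W)) :=
  fun j hj => iter_UkSel_covariantOn_solvable (N09LiftInvariance29AtRecord.succ_le_range_of_lt hj) (hsolU j hj)

/-! ## §2  Re-selection invariance of the junction's other `U_k`-mentioning binders (`huniq`, `hnest`) -/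

section Reselection

variable {k : ℕ}

/-- For two fine configurations in ONE residual orbit of level `k` the averages at a level `i ≤ m + K` differ by the level-`i` gauge transformation `u↾T⁽ⁱ⁾`
(r13 `iter_gaugeAct`). [cite: Balaban1987RG1, (0.21) p.256 (bookkeeping)] -/
theorem iter_eq_gaugeAct_of_orbitRel {U U' : GaugeField (F.P K) 0 (SU N)} (h : OrbitRel k U U') {i : ℕ} (hi : i ≤ (F.P K).m + (F.P K).K) :
    ∃ w : GaugeTransf (F.P K) i (SU N), Averaging.iter (avOfRecord F N K) i U' = gaugeAct w (Averaging.iter (avOfRecord F N K) i U) := by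
  obtain ⟨u, -, rfl⟩ := h
  exact ⟨toMS u i, iter_gaugeAct (avOfRecord F N K) u U i hi⟩

/-- **`huniq`'s body does not see the representative**: uniqueness of the minimal orbit at the averaged configuration `M^{j+1} U` is the same for every `U'` in the
residual orbit of `U` (the unique-orbit set is gauge-stable, dag-n09-w2 `uniqueUkOrbit_gaugeAct_iff`; `j + 1 ≤ m + K`). [cite: Balaban1985Variational, Thm 1 p.279 and (181) p.307] -/
theorem uniqueUkOrbit_iter_iff_of_orbitRel {U U' : GaugeField (F.P K) 0 (SU N)} (h : OrbitRel k U U') (δ : ℝ) {j : ℕ} (hj : j + 1 ≤ (F.P K).m + (F.P K).K) :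
    UniqueUkOrbit F N K (j + 1) δ (Averaging.iter (avOfRecord F N K) (j + 1) U') ↔ UniqueUkOrbit F N K (j + 1) δ (Averaging.iter (avOfRecord F N K) (j + 1) U) := by
  obtain ⟨w, hw⟩ := iter_eq_gaugeAct_of_orbitRel (F := F) (N := N) h hj
  rw [hw]
  exact uniqueUkOrbit_gaugeAct_iff hj δ w _

/-- **`hnest`'s body does not see the representative** for bookkeeping sets stable under the level-`i` gauge transformations (the closer's `hDst`-type letter, here at
level `i`): membership of `M^i U` is the same along a residual orbit. [cite: Balaban1987RG1, (2.16) p.269 (bookkeeping)] -/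
theorem mem_iter_iff_of_orbitRel_of_stable {U U' : GaugeField (F.P K) 0 (SU N)} (h : OrbitRel k U U') {i : ℕ} (hi : i ≤ (F.P K).m + (F.P K).K)
    {D : Set (GaugeField (F.P K) i (SU N))} (hDst : ∀ (w : GaugeTransf (F.P K) i (SU N)) (V : GaugeField (F.P K) i (SU N)), V ∈ D → gaugeAct w V ∈ D) :
    Averaging.iter (avOfRecord F N K) i U' ∈ D ↔ Averaging.iter (avOfRecord F N K) i U ∈ D := by
  constructor
  · intro hU'
    obtain ⟨w, hw⟩ := iter_eq_gaugeAct_of_orbitRel (F := F) (N := N) h.symm hi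
    rw [hw]
    exact hDst w _ hU'
  · intro hU
    obtain ⟨w, hw⟩ := iter_eq_gaugeAct_of_orbitRel (F := F) (N := N) h hi
    rw [hw]
    exact hDst w _ hU

/-- **`huniq` FOR THE OFFER ⟺ `huniq` FOR THE BARE CHOICE** at a datum `V` with a unique minimal orbit (the junction's `h11` at `V`): for `j < k ≤ m + K`,
`UniqueUkOrbit (j+1) δ (M^{j+1}(UkSel … V)) ↔ UniqueUkOrbit (j+1) δ (M^{j+1}(Uk … V))`. [cite: Balaban1985Variational, Thm 1 p.279 and (181) p.307] -/
theorem huniq_UkSel_iff (hk : k ≤ (F.P K).m + (F.P K).K) {V : GaugeField (F.P K) k (SU N)} (hV : UkExists F N K k ε V) (hu : UniqueUkOrbit F N K k ε V)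
    (δ : ℝ) {j : ℕ} (hj : j < k) :
    UniqueUkOrbit F N K (j + 1) δ (Averaging.iter (avOfRecord F N K) (j + 1) (UkSel F N K k ε V)) ↔
      UniqueUkOrbit F N K (j + 1) δ (Averaging.iter (avOfRecord F N K) (j + 1) (Uk F N K k ε V)) :=
  uniqueUkOrbit_iter_iff_of_orbitRel (orbitRel_Uk_UkSel hk hV hu) δ (le_trans (Nat.succ_le_of_lt hj) hk)

/-- **`hnest` FOR THE OFFER ⟺ `hnest` FOR THE BARE CHOICE** at such `V`, for a bookkeeping set `D` at level `i ≤ k` stable under the level-`i` gauge transformations: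
`M^i(UkSel … V) ∈ D ↔ M^i(Uk … V) ∈ D`. [cite: Balaban1987RG1, (2.16) p.269 (bookkeeping)] -/
theorem hnest_UkSel_iff (hk : k ≤ (F.P K).m + (F.P K).K) {V : GaugeField (F.P K) k (SU N)} (hV : UkExists F N K k ε V) (hu : UniqueUkOrbit F N K k ε V)
    {i : ℕ} (hi : i ≤ k) {D : Set (GaugeField (F.P K) i (SU N))}
    (hDst : ∀ (w : GaugeTransf (F.P K) i (SU N)) (V : GaugeField (F.P K) i (SU N)), V ∈ D → gaugeAct w V ∈ D) :
    Averaging.iter (avOfRecord F N K) i (UkSel F N K k ε V) ∈ D ↔ Averaging.iter (avOfRecord F N K) i (Uk F N K k ε V) ∈ D :=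
  mem_iter_iff_of_orbitRel_of_stable (orbitRel_Uk_UkSel hk hV hu) (le_trans hi hk) hDst

end Reselection

/-! ## §3  Non-vacuity of the solvable set at every level: `U₀ = 1` is a (0.21) minimiser over `V = 1` -/

section NonVacuity

variable {k : ℕ}

/-- The unit configuration has zero Wilson action (every plaquette variable is `1`, `Re tr 1 = 1`). [cite: Balaban1987RG1, (0.2) p.252 (bookkeeping)] -/
theorem wilsonAction4_unit (K j : ℕ) : wilsonAction4 (1 : GaugeField (F.P K) j (SU N)) = 0 := by
  unfold wilsonAction4 wilsonAction
  refine Finset.sum_eq_zero fun p _ => ?_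
  have h1 : GaugeField.plaqHol (1 : GaugeField (F.P K) j (SU N)) p = 1 := by
    simp only [GaugeField.plaqHol]
    show (1 : SU N) * 1 * 1⁻¹ * 1⁻¹ = 1
    group
  rw [h1, GaugeGroup.reTr_one, sub_self, mul_zero]

/-- **`U₀ = 1` IS A (0.21) MINIMISER OVER `V = 1`** at every level `k` and radius `0 < ε`: `M^k 1 = 1`, `1 ∈ bgReg`, `A(1) = 0 ≤ A(U)`. [cite: Balaban1987RG1, (0.21) p.256] -/
theorem isBackground_one_one (K k : ℕ) (hε : 0 < ε) :
    IsBackground (avOfRecord F N K) (bgReg F N K k ε) k (1 : GaugeField (F.P K) k (SU N)) (1 : GaugeField (F.P K) 0 (SU N)) := by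
  refine ⟨iter_avOfRecord_one F N K k, Node00.one_mem_bgReg K k hε, fun U _ _ => ?_⟩
  rw [wilsonAction4_unit]
  exact wilsonAction4_nonneg U

/-- **THE SOLVABLE SET IS INHABITED AT EVERY LEVEL**: `UkExists F N K k ε 1` for `0 < ε` — the domain of §1 and of FILE 1∕3's `IsBackground` contracts is non-empty at
every `K, k, ε > 0` (A6).  (Uniqueness at `V = 1` for `k ≥ 1` is [B11] Thm 1's content and stays displayed.) [cite: Balaban1987RG1, (0.21) p.256; Balaban1985Variational, Thm 1 p.279] -/
theorem ukExists_one (K k : ℕ) (hε : 0 < ε) : UkExists F N K k ε (1 : GaugeField (F.P K) k (SU N)) :=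
  ⟨1, isBackground_one_one K k hε⟩

/-- Hence both `Uk … 1` and `UkSel … 1` ARE (0.21) minimisers over the unit coarse field (their contracts fire; standing range for the offer).
[cite: Balaban1987RG1, (0.21) p.256] -/
theorem isBackground_Uk_and_UkSel_one (K : ℕ) (hk : k ≤ (F.P K).m + (F.P K).K) (hε : 0 < ε) :
    IsBackground (avOfRecord F N K) (bgReg F N K k ε) k 1 (Uk F N K k ε (1 : GaugeField (F.P K) k (SU N))) ∧
      IsBackground (avOfRecord F N K) (bgReg F N K k ε) k 1 (UkSel F N K k ε (1 : GaugeField (F.P K) k (SU N))) :=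
  ⟨isBackground_Uk (ukExists_one K k hε), isBackground_UkSel hk (ukExists_one K k hε)⟩

/-- In particular both have ZERO Wilson action over the unit coarse field (mutual minimality against `U₀ = 1`). [cite: Balaban1987RG1, (0.21)-(0.22) p.256] -/
theorem wilsonAction4_Uk_one (K k : ℕ) (hε : 0 < ε) : wilsonAction4 (Uk F N K k ε (1 : GaugeField (F.P K) k (SU N))) = 0 := by
  rw [← wilsonAction4_eq_of_isBackground (isBackground_one_one (F := F) (N := N) K k hε), wilsonAction4_unit]

end NonVacuity

end Summit.QuantumFields.YangMills.BalabanUVNodes.N09UkSelAtJunction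

end
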